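import Summits.CriticalPhenomena.CardyFormulaZ2.Theorems.CardyBondTriangularBondTriangularCardyCrudeLower
import Literature.Probability.Percolation.TriSepEscape
import Literature.Probability.Percolation.ScaleSelection

/-!
# Route CardyBondTriangular · crux `BondTriangularCardy` (stmt-CriticalPhenomena-4664), line `birth`,
# stub `stub_discreteDomains`, part (D2)+(D3), lower half: `f⁻¹_δ(z⁻_δ) - e(δ) ≤ P(crude crossing)`

Helper of the stub `stub_discreteDomains` (`Sig.discreteDomains`, sandwich clause): the LOWER
half of Bollobás–Riordan's sandwich (19) p. 184 combined with (40) p. 201 (Percolation, CUP 2006,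
Ch. 7; p. 203: "`P_δ(G_δ⁻) = f_δ²(z_δ) + o(1)`" and "`P_δ(G_δ⁻) - o(1) ≤ P_δ(D₄)`"), for critical
bond percolation on `𝕋` in its Chayes–Lei representation (`triBondCritical`, whose law is the
image of `P_{p_c}` under the packaging `clOfBond`, `map_clOfBond_bondPercolation`) and the crude
crossing event `embDomainCrossing` of the route at mesh `δ/√3`:

for a discrete approximation `G⁻_δ` of `R` which is eventually longer–thinner at every `(t, ρ)`
(the output of `discreteDomains_geometry`) and a hexagon model law with a yellow one-arm bound,
there are triangles `z⁻_δ` of `G⁻_δ` with centres in `Ω` tending to `R.pt 3` and `e(δ) → 0` with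
`f⁻¹_δ(z⁻_δ) - e(δ) ≤ P_{p_c}(crude crossing of Ω at mesh δ/√3 from A₀ to A₂)` eventually
(`sandwichLower_of_armBound`).

Proof. Configurationwise (`clSepEvent_one_subset_crossing_union`): with local data attaching the
triangle `z` to the fourth mark `v₃` inside a small ball `S` (`EscapeData`, supplied by
`escapeData_of_dist` from Claim 21 and the convergence of the marks), the separating event
`E¹(z)` of the hexagon model — a yellow path `P` of hexagons from `A₂ ∪ A₃` to `A₀` separating `z`
from `A₁⁺` — either meets `S` (the local bad event: a yellow arm from `S` to `A₀ ∪ A₁`, far away)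
or, by the model-free escape theorem `exists_mem_arc_two_of_separates_one`, meets `A₂`, so that a
sub-walk of `P` is a yellow crossing of `G` from `A₂` to `A₀`; the latter is a crude open crossing
of `Ω` or a yellow corner arm (`crude_or_cornerArm_of_yellowCrossing`). In probability
(`clSepProb_one_le_crude_add`): `f¹(z) = P_{p_c}(clOfBond⁻¹ E¹(z)) ≤ P_{p_c}(crude) + Σⱼ P(corner
arm at R.pt j) + P(local arm)`, the arm probabilities being those of the hexagon model
(`Measure.le_map_apply`); the yellow one-arm bound makes each `≤ ε/6` once the corner radius and
the ball are small, and the diagonal choice `exists_scale_tendsto` gives `e(δ) → 0`.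

References: B. Bollobás, O. Riordan, *Percolation*, CUP 2006, Ch. 7, (19) p. 184, Claim 20
p. 192, (40) p. 201, p. 203; L. Chayes, H. K. Lei, Rev. Math. Phys. 19 (2007) §2.1.
-/

noncomputable section

namespace Summit.CriticalPhenomena.CardyFormulaZ2.Theorems.BondTriangularCardyLine

open Set Filter Topology Metric MeasureTheory
open Literature.Probability.Percolation Literature.Probability.RandomPlanarGeometry
open Literature.Probability.RandomPlanarGeometry.MarkedDomain
open Literature.Probability.LatticeModels

/-! ### (40), forward direction, for the hexagon model: `E¹(z)` gives a yellow crossing `A₂ → A₀` or a local bad event -/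

/-- **`E¹(z)` forces a yellow crossing from `A₂` to `A₀`, off the local bad event** (the "only
if" direction of (40) of Bollobás–Riordan 2006, p. 201, for the Chayes–Lei representation): with
local data `EscapeData G z S`, a configuration of the hexagon model in the separating event
`E¹(z)` of the 3-marked domain `G.dropLast` (a yellow path of hexagons from `A₂ ∪ A₃` to `A₀`
separating `z` from `A₁⁺`) either has a hexagon of `S` joined by a yellow path to `A₀ ∪ A₁` (the
local bad event), or — the separating path avoiding `S` — a `𝕋`-walk of hexagons of `G`, none
pure blue, with yellow adjacencies, from a hexagon of `A₂(G)` to a hexagon of `A₀(G)` (a sub-walk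
of the separating path from its first visit to `A₂`, which exists by the model-free escape theorem
`exists_mem_arc_two_of_separates_one`). -/
theorem clSepEvent_one_subset_crossing_union (G : TriMarkedDomain 4) {z : HexVertex} {S : Set (Site 2)}
    (h : G.EscapeData z S) :
    G.dropLast.clSepEvent 1 z ⊆
      {σ | ∃ a ∈ G.arc 2, ∃ b ∈ G.arc 0, ∃ Q : triGraph.Walk a b,
        (∀ x ∈ Q.support, x ∈ G.verts ∧ σ x ≠ CLHexState.B) ∧ ∀ d ∈ Q.darts, (clYellowGraph σ).Adj d.fst d.snd} ∪
      {σ | ∃ s ∈ S, ∃ t, (t ∈ G.arc 0 ∨ t ∈ G.arc 1) ∧ (clYellowGraph σ).Reachable s t} := by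
  classical
  rintro σ ⟨du, dv, P, -, -, hv, -, -, hsupp, hdarts, hsep⟩
  have hv0 : dv.1 ∈ G.arc 0 := Finset.mem_image_of_mem _ hv
  by_cases hmeet : ∃ x ∈ P.support, x ∈ S
  · obtain ⟨x, hxP, hxS⟩ := hmeet
    exact Or.inr ⟨x, hxS, dv.1, Or.inl hv0, (clYellow_reachable_ends_of_darts P hdarts hxP).2⟩
  · push Not at hmeet
    have hS : ∀ x ∈ S, x ∉ P.support := fun x hxS hxP => hmeet x hxP hxS
    obtain ⟨y, hy, hyx⟩ := h.joined
    obtain ⟨p, hp1, hp2, hmk, hchain, hn1, hn2⟩ := h.after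
    have hsep' : Separates G.verts {e | e ∈ P.edges} z (G.stretch 1) := hsep
    obtain ⟨a, ha, haP⟩ := G.exists_mem_arc_two_of_separates_one P h.face hS hy hyx hp1 hp2 hmk hchain hn1 hn2 hsep'
    refine Or.inl ⟨a, ha, dv.1, hv0, P.dropUntil a haP, fun x hx => hsupp x (P.support_dropUntil_subset_support haP hx),
      fun d hd => hdarts d (P.darts_dropUntil_subset_darts haP hd)⟩

/-! ### The packaging map is measurable -/

/-- The Chayes–Lei packaging `clOfBond` of a bond configuration is measurable (a private copy of
the tree's `measurable_clOfBond` of `…StubThreeArmSmall.lean`, to keep the imports light). -/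
private theorem measurable_clOfBond' : Measurable clOfBond := by
  classical
  refine measurable_pi_lambda _ fun x => ?_
  exact (measurable_of_countable fun b : Fin 3 → Prop => stateOfBonds fun j => decide (b j)).comp
    (measurable_pi_lambda _ fun j => measurable_set_mem _)

/-- **Arm probabilities pull back**: the `P_p`-probability that the packaged configuration has a
property is at most its probability in the hexagon model `ofBond p` (an inequality for arbitrary,
possibly non-measurable, events: `Measure.le_map_apply`). -/
theorem bond_real_preimage_clOfBond_le (p : unitInterval) (E : Set CLHexConfig) :
    (bondPercolation triGraph p).real (clOfBond ⁻¹' E) ≤ (clHexPercolation (ChayesLeiHexPercolation.ofBond p)).real E := by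
  rw [← map_clOfBond_bondPercolation, measureReal_def, measureReal_def]
  exact ENNReal.toReal_mono (measure_ne_top _ _) (Measure.le_map_apply measurable_clOfBond'.aemeasurable E)

/-- The separating probability of the hexagon model `ofBond p` is the `P_p`-probability of the
pulled-back event (the event is measurable). -/
theorem clSepProb_ofBond_eq (p : unitInterval) (D : TriMarkedDomain 3) (i : Fin 3) (z : HexVertex) :
    D.clSepProb (ChayesLeiHexPercolation.ofBond p) i z = (bondPercolation triGraph p).real (clOfBond ⁻¹' D.clSepEvent i z) := by
  rw [TriMarkedDomain.clSepProb, ← map_clOfBond_bondPercolation,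
    map_measureReal_apply measurable_clOfBond' (D.measurableSet_clSepEvent i z)]

/-! ### The lower half of the sandwich in probability, at a fixed mesh -/

/-- **`f¹(z) ≤ P(crude) + corner arms + local arm` at a fixed mesh.** In the setting of
`crude_or_cornerArm_of_yellowCrossing` (a longer–thinner `G` at `(t, ρ)`, `δ < δ₀`, `t ≤ t₀`) and
with local data `EscapeData G z S` where `S` is the ball of radius `γ` about the centre of `z` in
which the arcs `A₀(G), A₁(G)` stay farther than `c/2` from that centre, the separating probability
of critical bond-`𝕋` satisfies `f¹(z) ≤ P_{p_c}(crude crossing) + Σⱼ P(yellow arm at R.pt j from ρ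
to r₂) + P(yellow arm at the centre of z from γ to c/2)`, the arm probabilities in the hexagon
model `ofBond p` (for any density `p`; the statement is deterministic in `p`). -/
theorem clSepProb_one_le_crude_add (p : unitInterval) (R : ConformalRectangle) {r₂ ρ δ t γ c : ℝ}
    (hcrude : ∀ (G : TriMarkedDomain 4), G.IsLongerThinner R δ t ρ →
      ∀ (ω : BondConfig (Site 2)), ω ⊆ triGraph.edgeSet →
      ∀ (a b : Site 2) (Q : triGraph.Walk a b), a ∈ G.arc 2 → b ∈ G.arc 0 →
        (∀ x ∈ Q.support, x ∈ G.verts ∧ clOfBond ω x ≠ CLHexState.B) →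
        (∀ d ∈ Q.darts, (clYellowGraph (clOfBond ω)).Adj d.fst d.snd) →
        ω ∈ embDomainCrossing (fun x : Site 2 ↦ (Real.sqrt 3 : ℂ) * (triEmbed x - (1 + triZeta) / 3))
            R.carrier (δ / Real.sqrt 3) (R.arc 0) (R.arc 2) ∨
          ∃ j : Fin 4, ∃ x y : Site 2, (clYellowGraph (clOfBond ω)).Reachable x y ∧
            ‖triMeshPoint δ x - R.pt j‖ < ρ ∧ r₂ < ‖triMeshPoint δ y - R.pt j‖)
    (G : TriMarkedDomain 4) (hG : G.IsLongerThinner R δ t ρ) {z : HexVertex}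
    (hE : G.EscapeData z {v | dist (triMeshPoint δ v) ((δ : ℂ) * hexCenter z) < γ})
    (harc : ∀ s, s ∈ G.arc 0 ∨ s ∈ G.arc 1 → c / 2 < dist (triMeshPoint δ s) ((δ : ℂ) * hexCenter z)) :
    G.dropLast.clSepProb (ChayesLeiHexPercolation.ofBond p) 1 z ≤
      (bondPercolation triGraph p).real (embDomainCrossing (fun x : Site 2 ↦ (Real.sqrt 3 : ℂ) * (triEmbed x - (1 + triZeta) / 3))
          R.carrier (δ / Real.sqrt 3) (R.arc 0) (R.arc 2)) +
      ∑ j : Fin 4, (clHexPercolation (ChayesLeiHexPercolation.ofBond p)).real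
          {σ | ∃ x y : Site 2, (clYellowGraph σ).Reachable x y ∧ ‖triMeshPoint δ x - R.pt j‖ < ρ ∧ r₂ < ‖triMeshPoint δ y - R.pt j‖} +
      (clHexPercolation (ChayesLeiHexPercolation.ofBond p)).real
          {σ | ∃ x y : Site 2, (clYellowGraph σ).Reachable x y ∧
            ‖triMeshPoint δ x - (δ : ℂ) * hexCenter z‖ < γ ∧ c / 2 < ‖triMeshPoint δ y - (δ : ℂ) * hexCenter z‖} := by
  classical
  set μ := bondPercolation triGraph p with hμ
  set Crude : Set (BondConfig (Site 2)) := embDomainCrossing (fun x : Site 2 ↦ (Real.sqrt 3 : ℂ) * (triEmbed x - (1 + triZeta) / 3))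
      R.carrier (δ / Real.sqrt 3) (R.arc 0) (R.arc 2) with hCrude
  set Arm : Fin 4 → Set CLHexConfig := fun j =>
    {σ | ∃ x y : Site 2, (clYellowGraph σ).Reachable x y ∧ ‖triMeshPoint δ x - R.pt j‖ < ρ ∧ r₂ < ‖triMeshPoint δ y - R.pt j‖} with hArm
  set Loc : Set CLHexConfig := {σ | ∃ x y : Site 2, (clYellowGraph σ).Reachable x y ∧
      ‖triMeshPoint δ x - (δ : ℂ) * hexCenter z‖ < γ ∧ c / 2 < ‖triMeshPoint δ y - (δ : ℂ) * hexCenter z‖} with hLoc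
  set Bad : Set (BondConfig (Site 2)) := {ω | ¬ ω ⊆ triGraph.edgeSet} with hBad
  -- the configurationwise inclusion
  have hincl : clOfBond ⁻¹' G.dropLast.clSepEvent 1 z ⊆ (Crude ∪ ⋃ j : Fin 4, clOfBond ⁻¹' Arm j) ∪ clOfBond ⁻¹' Loc ∪ Bad := by
    intro ω hω
    by_cases hωE : ω ⊆ triGraph.edgeSet
    · rcases clSepEvent_one_subset_crossing_union G hE hω with ⟨a, ha, b, hb, Q, hsupp, hdarts⟩ | ⟨s, hs, s', hs', hreach⟩
      · left
        rcases hcrude G hG ω hωE a b Q ha hb hsupp hdarts with hc | ⟨j, x, y, hxy, hx, hy⟩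
        · exact Or.inl (Or.inl hc)
        · exact Or.inl (Or.inr (mem_iUnion.2 ⟨j, x, y, hxy, hx, hy⟩))
      · left; right
        refine ⟨s, s', hreach, by rw [← dist_eq_norm]; exact hs, ?_⟩
        rw [← dist_eq_norm]; exact harc s' hs'
    · exact Or.inr hωE
  -- the bad set is null
  have hBad0 : μ.real Bad = 0 := by
    have hae := ae_subset_edgeSet triGraph p
    rw [measureReal_def, ENNReal.toReal_eq_zero_iff]
    exact Or.inl (ae_iff.1 hae)
  -- union bounds
  rw [clSepProb_ofBond_eq]
  calc μ.real (clOfBond ⁻¹' G.dropLast.clSepEvent 1 z)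
      ≤ μ.real ((Crude ∪ ⋃ j : Fin 4, clOfBond ⁻¹' Arm j) ∪ clOfBond ⁻¹' Loc ∪ Bad) := measureReal_mono hincl (measure_ne_top _ _)
    _ ≤ μ.real ((Crude ∪ ⋃ j : Fin 4, clOfBond ⁻¹' Arm j) ∪ clOfBond ⁻¹' Loc) + μ.real Bad := measureReal_union_le _ _
    _ ≤ (μ.real (Crude ∪ ⋃ j : Fin 4, clOfBond ⁻¹' Arm j) + μ.real (clOfBond ⁻¹' Loc)) + 0 := by
        rw [hBad0]; exact add_le_add (measureReal_union_le _ _) le_rfl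
    _ ≤ (μ.real Crude + μ.real (⋃ j : Fin 4, clOfBond ⁻¹' Arm j)) + μ.real (clOfBond ⁻¹' Loc) + 0 := by
        gcongr; exact measureReal_union_le _ _
    _ ≤ (μ.real Crude + ∑ j : Fin 4, μ.real (clOfBond ⁻¹' Arm j)) + μ.real (clOfBond ⁻¹' Loc) + 0 := by
        gcongr; exact measureReal_iUnion_fintype_le _
    _ ≤ μ.real Crude + ∑ j : Fin 4, (clHexPercolation (ChayesLeiHexPercolation.ofBond p)).real (Arm j) +
          (clHexPercolation (ChayesLeiHexPercolation.ofBond p)).real Loc := by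
        rw [add_zero]
        gcongr with j
        · exact bond_real_preimage_clOfBond_le p (Arm j)
        · exact bond_real_preimage_clOfBond_le p Loc

/-! ### The lower half of the sandwich for a family of longer–thinner discrete approximations -/

/-- **(D2)+(D3), lower half: `f⁻¹_δ(z⁻_δ) - e(δ) ≤ P_{p_c}(crude crossing)`, `e → 0`.** Assume the
yellow one-arm bound for the Chayes–Lei representation of critical bond-`𝕋` (`∀ ε > 0, ∃ ρ, C > 0`,
a yellow path from `B(z, r₁)` to `∁B(z, r₂)` has probability `≤ ε` once `C δ ≤ r₁ ≤ ρ r₂`). Let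
`G⁻_δ` be a discrete approximation of the conformal rectangle `R` which is eventually
longer–thinner than `R` at every `(t, ρ)`. Then there are triangles `z⁻_δ` of `G⁻_δ` with centres in
`Ω` tending to `R.pt 3` and `e(δ) → 0` such that, eventually as `δ → 0⁺`, the Chayes–Lei separating
probability satisfies `f⁻¹_δ(z⁻_δ) - e(δ) ≤ P_{p_c}(embDomainCrossing (√3 (triEmbed · - (1+ζ)/3)) Ω (δ/√3) A₀ A₂)`
— Bollobás–Riordan's `P_δ(G_δ⁻) = f_δ²(z_δ) + o(1)` ((40) p. 201 at `z = P₄`, p. 203) and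
`P_δ(G_δ⁻) - o(1) ≤ P_δ(D₄)` ((19) p. 184, Claim 20 p. 192) for bond-`𝕋`, through
`clSepProb_one_le_crude_add`, the local data of `escapeData_of_dist` (Claim 21 and the
convergence of the marks) and the diagonal choice `exists_scale_tendsto`. -/
theorem sandwichLower_of_armBound :
    (∀ ε > (0 : ℝ), ∃ ρ > (0 : ℝ), ∃ C > (0 : ℝ), ∀ (δ : ℝ) (z : ℂ) (r₁ r₂ : ℝ), 0 < δ → C * δ ≤ r₁ → r₁ ≤ ρ * r₂ →
      (Literature.Probability.Percolation.clHexPercolation Literature.Probability.Percolation.ChayesLeiHexPercolation.triBondCritical).real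
        {σ | ∃ x y : Literature.Probability.LatticeModels.Site 2, (Literature.Probability.Percolation.clYellowGraph σ).Reachable x y ∧
          ‖Literature.Probability.LatticeModels.triMeshPoint δ x - z‖ < r₁ ∧ r₂ < ‖Literature.Probability.LatticeModels.triMeshPoint δ y - z‖} ≤ ε) →
    ∀ (R : Literature.Probability.RandomPlanarGeometry.ConformalRectangle) (Gm : ℝ → Literature.Probability.Percolation.TriMarkedDomain 4),
      Literature.Probability.Percolation.IsDiscreteApprox R Gm →
      (∀ ρ > (0 : ℝ), ∀ t > (0 : ℝ), ∀ᶠ δ : ℝ in nhdsWithin (0 : ℝ) (Set.Ioi 0), (Gm δ).IsLongerThinner R δ t ρ) →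
      ∃ (zm : ℝ → Literature.Probability.LatticeModels.HexVertex) (e : ℝ → ℝ),
        (∀ᶠ δ : ℝ in nhdsWithin (0 : ℝ) (Set.Ioi 0), zm δ ∈ (Gm δ).faces ∧ (δ : ℂ) * Literature.Probability.LatticeModels.hexCenter (zm δ) ∈ R.carrier) ∧
        Filter.Tendsto (fun δ : ℝ => (δ : ℂ) * Literature.Probability.LatticeModels.hexCenter (zm δ)) (nhdsWithin (0 : ℝ) (Set.Ioi 0)) (nhds (R.pt 3)) ∧
        Filter.Tendsto e (nhdsWithin (0 : ℝ) (Set.Ioi 0)) (nhds 0) ∧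
        ∀ᶠ δ : ℝ in nhdsWithin (0 : ℝ) (Set.Ioi 0),
          (Gm δ).dropLast.clSepProb Literature.Probability.Percolation.ChayesLeiHexPercolation.triBondCritical 1 (zm δ) - e δ ≤
            (Literature.Probability.Percolation.bondPercolation Literature.Probability.LatticeModels.triGraph
                (Literature.Probability.LatticeModels.criticalWeightI (Real.pi / 6))).real
              (Literature.Probability.Percolation.embDomainCrossing
                (fun x : Literature.Probability.LatticeModels.Site 2 ↦ (Real.sqrt 3 : ℂ) * (Literature.Probability.LatticeModels.triEmbed x - (1 + Literature.Probability.LatticeModels.triZeta) / 3))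
                R.carrier (δ / Real.sqrt 3) (R.arc 0) (R.arc 2)) := by
  intro harm R G hG hLT
  classical
  have hd' : R.pt 3 ∈ closure R.carrier := frontier_subset_closure (R.pt_mem_frontier 3)
  obtain ⟨zs, hzs, hzt⟩ := hG.exists_faces_tendsto hd'
  -- notation for the crude crossing probability
  set Pb : ℝ → ℝ := fun δ => (bondPercolation triGraph (criticalWeightI (Real.pi / 6))).real
      (embDomainCrossing (fun x : Site 2 ↦ (Real.sqrt 3 : ℂ) * (triEmbed x - (1 + triZeta) / 3))
        R.carrier (δ / Real.sqrt 3) (R.arc 0) (R.arc 2)) with hPb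
  -- the arcs `A₀, A₁` of `R` stay away from `d' = R.pt 3`
  have hn0 : R.pt 3 ∉ R.arc 0 := fun h =>
    (R.eq_pt_or_eq_pt_of_mem_arc (i := 0) (j := 3) (by decide) h (R.pt_mem_arc_self 3)).elim
      (fun e => absurd (R.pt_injective e) (by decide)) (fun e => absurd (R.pt_injective e) (by decide))
  have hn1 : R.pt 3 ∉ R.arc 1 := fun h =>
    (R.eq_pt_or_eq_pt_of_mem_arc (i := 1) (j := 3) (by decide) h (R.pt_mem_arc_self 3)).elim
      (fun e => absurd (R.pt_injective e) (by decide)) (fun e => absurd (R.pt_injective e) (by decide))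
  set c₀ : ℝ := min (infDist (R.pt 3) (R.arc 0)) (infDist (R.pt 3) (R.arc 1)) with hc₀def
  have hc₀ : 0 < c₀ :=
    lt_min (((R.isClosed_arc 0).notMem_iff_infDist_pos ⟨_, R.pt_mem_arc_self 0⟩).1 hn0)
      (((R.isClosed_arc 1).notMem_iff_infDist_pos ⟨_, R.pt_mem_arc_self 1⟩).1 hn1)
  have hfar0 : ∀ w ∈ R.arc 0, c₀ ≤ dist w (R.pt 3) := fun w hw =>
    (min_le_left _ _).trans (by rw [dist_comm]; exact infDist_le_dist_of_mem hw)
  have hfar1 : ∀ w ∈ R.arc 1, c₀ ≤ dist w (R.pt 3) := fun w hw =>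
    (min_le_right _ _).trans (by rw [dist_comm]; exact infDist_le_dist_of_mem hw)
  set c : ℝ := c₀ / 2 with hcdef
  have hc : 0 < c := by positivity
  have hcarc : ∀ᶠ δ in 𝓝[>] (0 : ℝ), ∀ t, t ∈ (G δ).arc 0 ∨ t ∈ (G δ).arc 1 →
      c ≤ dist (triMeshPoint δ t) (R.pt 3) := by
    filter_upwards [hG.eventually_le_dist_of_arc hc₀ hfar0, hG.eventually_le_dist_of_arc hc₀ hfar1]
      with δ h0 h1 t ht
    rcases ht with ht | ht
    · exact h0 t ht
    · exact h1 t ht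
  -- the marked sites `v₀, v₁, v₂` stay away from `d'`, and `v₃ → d'`
  obtain ⟨ρm, hρm, hρfar⟩ := hG.exists_eventually_le_dist_markSite 3
  have hv3 := hG.tendsto_markSite 3
  -- the lower inclusion thresholds
  obtain ⟨r₂, hr₂, hcr⟩ := crude_or_cornerArm_of_yellowCrossing R
  -- the core estimate: eventually `f¹(z_δ) ≤ P(crude) + ε`
  have key : ∀ ε > (0 : ℝ), ∀ᶠ δ in 𝓝[>] (0 : ℝ),
      (G δ).dropLast.clSepProb ChayesLeiHexPercolation.triBondCritical 1 (zs δ) ≤ Pb δ + ε := by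
    intro ε hε
    obtain ⟨ρa, hρa, Ca, hCa, hbound⟩ := harm (ε / 6) (by positivity)
    -- corner radius and local radius
    set ρc : ℝ := min r₂ (ρa * r₂) with hρc
    have hρc0 : 0 < ρc := lt_min hr₂ (mul_pos hρa hr₂)
    have hρcr : ρc ≤ r₂ := min_le_left _ _
    have hρca : ρc ≤ ρa * r₂ := min_le_right _ _
    obtain ⟨δ₀, hδ₀, t₀, ht₀, hcr'⟩ := hcr ρc hρc0 hρcr
    have hLTev := hLT ρc hρc0 t₀ ht₀
    set γ : ℝ := ρa * (c / 2) with hγdef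
    have hγ : 0 < γ := by positivity
    obtain ⟨η, hη, hconn⟩ := hG.site_conn (γ / 2) (by positivity)
    set θ : ℝ := min (γ / 1000) (min (ρm / 60) (min (η / 4) (c / 4))) with hθ
    have hθpos : 0 < θ := by positivity
    have hθγ : θ ≤ γ / 1000 := min_le_left _ _
    have hθρ : θ ≤ ρm / 60 := (min_le_right _ _).trans (min_le_left _ _)
    have hθη : θ ≤ η / 4 := (min_le_right _ _).trans ((min_le_right _ _).trans (min_le_left _ _))
    have hθc : θ ≤ c / 4 := (min_le_right _ _).trans ((min_le_right _ _).trans (min_le_right _ _))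
    have hK : ∀ᶠ δ : ℝ in 𝓝[>] 0, dist ((δ : ℂ) * hexCenter (zs δ)) (R.pt 3) < θ :=
      hzt.eventually (ball_mem_nhds _ hθpos)
    have hV : ∀ᶠ δ in 𝓝[>] (0 : ℝ), dist (triMeshPoint δ ((G δ).markSite 3)) (R.pt 3) < θ :=
      hv3.eventually (ball_mem_nhds _ hθpos)
    have hsmall : ∀ᶠ δ in 𝓝[>] (0 : ℝ), δ ∈ Ioo 0 (min θ (min δ₀ (min (ρc / Ca) (γ / Ca)))) :=
      Ioo_mem_nhdsGT (by positivity)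
    filter_upwards [hzs, hcarc, hρfar, hconn, hK, hV, hsmall, hLTev] with δ hzs hcarc hρfar hconn hK hV hδ hLTδ
    have hδpos : 0 < δ := hδ.1
    have hδθ : δ < θ := hδ.2.trans_le (min_le_left _ _)
    have hδδ₀ : δ < δ₀ := hδ.2.trans_le ((min_le_right _ _).trans (min_le_left _ _))
    have hCρ : Ca * δ ≤ ρc := by
      have h := hδ.2.trans_le ((min_le_right _ _).trans ((min_le_right _ _).trans (min_le_left _ _)))
      rw [lt_div_iff₀ hCa] at h; linarith
    have hCγ : Ca * δ ≤ γ := by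
      have h := hδ.2.trans_le ((min_le_right _ _).trans ((min_le_right _ _).trans (min_le_right _ _)))
      rw [lt_div_iff₀ hCa] at h; linarith
    set K : ℂ := (δ : ℂ) * hexCenter (zs δ) with hKdef
    have h3K : dist (triMeshPoint δ ((G δ).markSite 3)) K < 2 * θ := by
      calc dist (triMeshPoint δ ((G δ).markSite 3)) K
          ≤ dist (triMeshPoint δ ((G δ).markSite 3)) (R.pt 3) + dist (R.pt 3) K := dist_triangle _ _ _
        _ < θ + θ := add_lt_add hV (by rw [dist_comm]; exact hK)
        _ = 2 * θ := by ring
    -- a vertex of `z_δ` is joined to `v₃` inside the ball of radius `γ`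
    have hjoin : ∃ y ∈ hexFaceVertices (zs δ), PathIn triGraph
        (((G δ).verts : Set (Site 2)) ∩ {v | dist (triMeshPoint δ v) ((δ : ℂ) * hexCenter (zs δ)) < γ})
          y ((G δ).markSite 3) := by
      have hy : faceVertex (zs δ) 0 ∈ (G δ).verts := ((G δ).mem_faces).1 hzs.1 (faceVertex_mem _ _)
      have hyK : dist (triMeshPoint δ (faceVertex (zs δ) 0)) K ≤ δ := by
        have := dist_triMeshPoint_hexCenter_le (faceVertex_mem (zs δ) 0) δ
        rwa [abs_of_pos hδpos] at this
      have hdist : dist (triMeshPoint δ (faceVertex (zs δ) 0)) (triMeshPoint δ ((G δ).markSite 3)) < η := by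
        calc dist (triMeshPoint δ (faceVertex (zs δ) 0)) (triMeshPoint δ ((G δ).markSite 3))
            ≤ dist (triMeshPoint δ (faceVertex (zs δ) 0)) K + dist K (triMeshPoint δ ((G δ).markSite 3)) :=
              dist_triangle _ _ _
          _ < δ + 2 * θ := by rw [dist_comm K]; exact add_lt_add_of_le_of_lt hyK h3K
          _ < η := by linarith
      refine ⟨faceVertex (zs δ) 0, faceVertex_mem _ _, ?_⟩
      refine (hconn _ hy _ ((G δ).markSite_mem_verts 3) hdist).mono ?_
      rintro v ⟨hv, hvd⟩
      refine ⟨hv, ?_⟩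
      have hvd' : dist (triMeshPoint δ (faceVertex (zs δ) 0)) (triMeshPoint δ v) < γ / 2 := hvd
      show dist (triMeshPoint δ v) K < γ
      calc dist (triMeshPoint δ v) K
          ≤ dist (triMeshPoint δ v) (triMeshPoint δ (faceVertex (zs δ) 0)) +
            dist (triMeshPoint δ (faceVertex (zs δ) 0)) K := dist_triangle _ _ _
        _ < γ / 2 + δ := by rw [dist_comm]; exact add_lt_add_of_lt_of_le hvd' hyK
        _ ≤ γ := by linarith
    have h3 : dist (triMeshPoint δ ((G δ).markSite 3)) ((δ : ℂ) * hexCenter (zs δ)) + 13 * δ < γ := by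
      show dist (triMeshPoint δ ((G δ).markSite 3)) K + 13 * δ < γ
      linarith
    have hfar : ∀ j : Fin 4, j ≠ 3 →
        26 * δ < dist (triMeshPoint δ ((G δ).markSite j)) (triMeshPoint δ ((G δ).markSite 3)) := by
      intro j hj
      have h1 := hρfar j hj
      have := dist_triangle (triMeshPoint δ ((G δ).markSite j)) (triMeshPoint δ ((G δ).markSite 3)) (R.pt 3)
      linarith
    have harc : ∀ t, t ∈ (G δ).arc 0 ∨ t ∈ (G δ).arc 1 →
        c / 2 < dist (triMeshPoint δ t) ((δ : ℂ) * hexCenter (zs δ)) := by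
      intro t ht
      show c / 2 < dist (triMeshPoint δ t) K
      have h1 := hcarc t ht
      have := dist_triangle (triMeshPoint δ t) K (R.pt 3)
      linarith
    have hE := (G δ).escapeData_of_dist hδpos hzs.1 hjoin h3 hfar
    -- the estimate at mesh `δ`
    have hle := clSepProb_one_le_crude_add (criticalWeightI (Real.pi / 6)) R (r₂ := r₂) (ρ := ρc) (c := c)
      (hcr' δ t₀ hδpos hδδ₀ ht₀.le le_rfl) (G δ) hLTδ hE harc
    have hcorner : ∀ j : Fin 4, (clHexPercolation ChayesLeiHexPercolation.triBondCritical).real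
        {σ | ∃ x y : Site 2, (clYellowGraph σ).Reachable x y ∧ ‖triMeshPoint δ x - R.pt j‖ < ρc ∧ r₂ < ‖triMeshPoint δ y - R.pt j‖} ≤ ε / 6 :=
      fun j => hbound δ (R.pt j) ρc r₂ hδpos hCρ hρca
    have hloc : (clHexPercolation ChayesLeiHexPercolation.triBondCritical).real
        {σ | ∃ x y : Site 2, (clYellowGraph σ).Reachable x y ∧
          ‖triMeshPoint δ x - (δ : ℂ) * hexCenter (zs δ)‖ < γ ∧ c / 2 < ‖triMeshPoint δ y - (δ : ℂ) * hexCenter (zs δ)‖} ≤ ε / 6 :=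
      hbound δ _ γ (c / 2) hδpos hCγ le_rfl
    have hsum : ∑ j : Fin 4, (clHexPercolation ChayesLeiHexPercolation.triBondCritical).real
        {σ | ∃ x y : Site 2, (clYellowGraph σ).Reachable x y ∧ ‖triMeshPoint δ x - R.pt j‖ < ρc ∧ r₂ < ‖triMeshPoint δ y - R.pt j‖} ≤ 4 * (ε / 6) := by
      calc ∑ j : Fin 4, (clHexPercolation ChayesLeiHexPercolation.triBondCritical).real
            {σ | ∃ x y : Site 2, (clYellowGraph σ).Reachable x y ∧ ‖triMeshPoint δ x - R.pt j‖ < ρc ∧ r₂ < ‖triMeshPoint δ y - R.pt j‖}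
          ≤ ∑ _j : Fin 4, ε / 6 := Finset.sum_le_sum fun j _ => hcorner j
        _ = 4 * (ε / 6) := by simp
    change (G δ).dropLast.clSepProb (ChayesLeiHexPercolation.ofBond (criticalWeightI (Real.pi / 6))) 1 (zs δ) ≤ Pb δ + ε
    change (G δ).dropLast.clSepProb (ChayesLeiHexPercolation.ofBond (criticalWeightI (Real.pi / 6))) 1 (zs δ) ≤ _ at hle
    have hPbδ : Pb δ = (bondPercolation triGraph (criticalWeightI (Real.pi / 6))).real
        (embDomainCrossing (fun x : Site 2 ↦ (Real.sqrt 3 : ℂ) * (triEmbed x - (1 + triZeta) / 3))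
          R.carrier (δ / Real.sqrt 3) (R.arc 0) (R.arc 2)) := rfl
    rw [hPbδ]
    change _ ≤ _ + ∑ j : Fin 4, (clHexPercolation ChayesLeiHexPercolation.triBondCritical).real _ +
      (clHexPercolation ChayesLeiHexPercolation.triBondCritical).real _ at hle
    linarith
  -- the diagonal choice of `e`
  have hPall : ∀ ε > (0 : ℝ), ∃ δ₁ > (0 : ℝ), ∀ δ, 0 < δ → δ < δ₁ →
      (G δ).dropLast.clSepProb ChayesLeiHexPercolation.triBondCritical 1 (zs δ) ≤ Pb δ + ε := by
    intro ε hε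
    obtain ⟨δ₁, hδ₁, h⟩ := exists_forall_Ioo_of_eventually (key ε hε)
    exact ⟨δ₁, hδ₁, fun δ hδ hδ₁' => h δ ⟨hδ, hδ₁'⟩⟩
  obtain ⟨e, he, -, heP⟩ := exists_scale_tendsto hPall
  refine ⟨zs, e, hzs, hzt, he, heP.mono fun δ hδ => ?_⟩
  change (G δ).dropLast.clSepProb ChayesLeiHexPercolation.triBondCritical 1 (zs δ) - e δ ≤ Pb δ
  linarith

end Summit.CriticalPhenomena.CardyFormulaZ2.Theorems.BondTriangularCardyLine

end
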